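import Mathlib

/-!
# Route «KPlusLogSqLaw», crux `WeakLifting` (stmt-ValiantsHypothesis-19561) — quarter-turn / half-turn strip count, door (A′):
# HERMITIAN NO-CROSSING IDENTITY and REAL BLOCKS NEVER SINGULAR (kernel cores)

HONEST FRAMING.  Helper lemmas (`--supports stmt-ValiantsHypothesis-19561 --as helper`), seat pub-symmetroid-conjb-2 (g14 core, g15 filing +
the skew lemmas), cell `pub-symmetroid`, 2026-08-28; desk word pre-registered R2424 (B)(2).  Pure finite-dimensional linear algebra over `ℝ`/`ℂ`;
nothing here is an upper bound on any root count and nothing bears on `WeakLifting` / `TropicalB` (stmt-19771) in their windows, on Conjecture B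
(`KPlusLogSqLaw`), on the Door-A registers, on `MatrixDescartes` (stmt-18050) or on VP ≠ VNP.

CONTEXT (paper, cell deposit HOME/pub-symmetroid-conjb-2/g14/theory/THEORY-NOTE-g14.md §3.5, §4; g15 NOTES).  For a definite static tridiagonal
design the continuant `Q(x) = det(I − J₀ G(x))` (`J₀` real symmetric Jacobi, `G = diag(x^{g_j})`) vanishes at `x ≠ 0` iff `J₀ v = diag(x^{−g_j}) v`
for some `v ≠ 0`.
* `sum_im_mul_normSq_eq_zero` (g14): then `Σ_j Im(x^{−g_j})·|v_j|² = 0` — so no zero lies on a ray where the signs of `Im(x^{−g_j})` are coherent.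
* `eq_zero_of_skew_fixed`, `eq_zero_of_oppositeSign_coupling`, `det_diagonal_sub_ne_zero` (g15): a real symmetric `J` that only couples indices
  carrying OPPOSITE signs `σ_i = −σ_k` (`σ_i² = 1`) satisfies `ker_ℂ(diag σ − J) = 0`, because `diag(σ)·J` is real SKEW.  On the imaginary axis
  `x = iω` the sites split into «real» blocks (where `x^{−g_j} = ±1`, alternating along the block) and «imaginary» blocks; the real-block part
  `E_R − H_RR(ω)` of the normal form is of exactly this shape for EVERY `ω > 0` and ALL positive weights, hence never singular, and `Q(iω)` factors
  through the Schur complement on the imaginary sites (paper; the typed consequence is not claimed here).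
[this seat; folklore: `Re⟨Kv,v⟩ = 0` for real skew `K`]
-/

-- `Summit.ValiantsHypothesis.ValiantsHypothesis.…` repeats a component by the D-0017 layout (single-conjunct summit); the name is mandated.
set_option linter.dupNamespace false

namespace Summit.ValiantsHypothesis.ValiantsHypothesis.Theorems.KPlusLogSqLaw.StripNoCrossing

open Matrix Finset Complex

variable {m : ℕ}

/-! ## 1. Hermitian no-crossing identity (g14 core, unchanged) -/

/-- the imaginary part of `conj z * w` is antisymmetric under swapping `z` and `w`. -/
lemma im_conj_mul_antisymm (z w : ℂ) : ((starRingEnd ℂ) z * w).im = -((starRingEnd ℂ) w * z).im := by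
  simp [Complex.mul_im, Complex.conj_re, Complex.conj_im]
  ring

/-- `conj z * (d * z) = d * |z|²`, imaginary part. -/
lemma im_conj_mul_mul_self (d z : ℂ) : ((starRingEnd ℂ) z * (d * z)).im = d.im * Complex.normSq z := by
  have : (starRingEnd ℂ) z * (d * z) = d * (z * (starRingEnd ℂ) z) := by ring
  rw [this, Complex.mul_conj, Complex.mul_im, Complex.ofReal_re, Complex.ofReal_im]
  ring

/-- NO-CROSSING CORE: a real symmetric `J` with `J v = diag(d) v` forces `Σ_j Im(d_j) |v_j|² = 0`. -/
theorem sum_im_mul_normSq_eq_zero (J : Matrix (Fin m) (Fin m) ℝ) (hJ : ∀ i j, J i j = J j i)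
    (d v : Fin m → ℂ) (h : ∀ i, ∑ k, (J i k : ℂ) * v k = d i * v i) :
    ∑ j, (d j).im * Complex.normSq (v j) = 0 := by
  -- Σ_j Im(conj v_j · d_j v_j) = Σ_j Σ_k J_jk Im(conj v_j · v_k), an antisymmetric double sum
  have step : ∀ j, (d j).im * Complex.normSq (v j) = ∑ k, J j k * ((starRingEnd ℂ) (v j) * v k).im := by
    intro j
    rw [← im_conj_mul_mul_self, ← h j, Finset.mul_sum, Complex.im_sum]
    refine Finset.sum_congr rfl fun k _ => ?_
    have : (starRingEnd ℂ) (v j) * ((J j k : ℂ) * v k) = (J j k : ℂ) * ((starRingEnd ℂ) (v j) * v k) := by ring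
    rw [this]
    simp [Complex.mul_im, Complex.ofReal_re, Complex.ofReal_im]
  simp_rw [step]
  -- the double sum S satisfies S = -S
  have anti : ∑ j, ∑ k, J j k * ((starRingEnd ℂ) (v j) * v k).im
      = -(∑ j, ∑ k, J j k * ((starRingEnd ℂ) (v j) * v k).im) := by
    conv_rhs => rw [Finset.sum_comm]
    rw [← Finset.sum_neg_distrib]
    refine Finset.sum_congr rfl fun j _ => ?_
    rw [← Finset.sum_neg_distrib]
    refine Finset.sum_congr rfl fun k _ => ?_
    rw [hJ k j, im_conj_mul_antisymm (v k) (v j)]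
    ring
  linarith

/-! ## 2. Real skew matrices have no complex fixed vectors; opposite-sign coupling (g15) -/

/-- the real part of `conj z * w` is symmetric under swapping `z` and `w`. -/
lemma re_conj_mul_symm (z w : ℂ) : ((starRingEnd ℂ) z * w).re = ((starRingEnd ℂ) w * z).re := by
  simp [Complex.mul_re, Complex.conj_re, Complex.conj_im]
  ring

/-- SKEW NO-KERNEL: a real skew-symmetric `K` has no complex fixed vector: `K v = v ⇒ v = 0` (i.e. `I − K` is invertible over `ℂ`),
because `Re ⟨K v, v⟩ = 0` while `⟨v, v⟩ = Σ |v_j|²`. -/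
theorem eq_zero_of_skew_fixed (K : Matrix (Fin m) (Fin m) ℝ) (hK : ∀ i j, K i j = -K j i)
    (v : Fin m → ℂ) (h : ∀ i, ∑ k, (K i k : ℂ) * v k = v i) : v = 0 := by
  have step : ∀ j, Complex.normSq (v j) = ∑ k, K j k * ((starRingEnd ℂ) (v j) * v k).re := by
    intro j
    have e1 : ((starRingEnd ℂ) (v j) * ∑ k, (K j k : ℂ) * v k).re = Complex.normSq (v j) := by
      rw [h j, mul_comm, Complex.mul_conj, Complex.ofReal_re]
    rw [← e1, Finset.mul_sum, Complex.re_sum]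
    refine Finset.sum_congr rfl fun k _ => ?_
    have : (starRingEnd ℂ) (v j) * ((K j k : ℂ) * v k) = (K j k : ℂ) * ((starRingEnd ℂ) (v j) * v k) := by ring
    rw [this]
    simp [Complex.mul_re, Complex.ofReal_re, Complex.ofReal_im]
  -- the double sum T satisfies T = -T (K antisymmetric, Re(conj v_j · v_k) symmetric)
  have anti : ∑ j, ∑ k, K j k * ((starRingEnd ℂ) (v j) * v k).re
      = -(∑ j, ∑ k, K j k * ((starRingEnd ℂ) (v j) * v k).re) := by
    conv_rhs => rw [Finset.sum_comm]
    rw [← Finset.sum_neg_distrib]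
    refine Finset.sum_congr rfl fun j _ => ?_
    rw [← Finset.sum_neg_distrib]
    refine Finset.sum_congr rfl fun k _ => ?_
    rw [hK k j, re_conj_mul_symm (v k) (v j)]
    ring
  have total : ∑ j, Complex.normSq (v j) = 0 := by
    simp_rw [step]
    linarith
  have each := (Finset.sum_eq_zero_iff_of_nonneg fun j (_ : j ∈ (Finset.univ : Finset (Fin m))) =>
    Complex.normSq_nonneg (v j)).1 total
  funext j
  exact Complex.normSq_eq_zero.1 (each j (Finset.mem_univ j))

/-- OPPOSITE-SIGN COUPLING ⇒ NEVER SINGULAR: if a real symmetric `J` couples only indices carrying opposite signs (`J i k ≠ 0 ⇒ σ_i = −σ_k`,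
with `σ_i² = 1`), then `J v = σ v` has only the trivial complex solution — `diag(σ) − J` is invertible over `ℂ`, whatever the entries of `J`.
(`diag(σ)·J` is real skew and fixes `v`.)  Model case: `J` a Jacobi matrix with zero diagonal and `σ` alternating `±1` along each of its blocks —
the real-block part `E_R − H_RR(ω)` of the imaginary-axis normal form of a static tridiagonal design, for every `ω > 0` and all positive weights. -/
theorem eq_zero_of_oppositeSign_coupling (J : Matrix (Fin m) (Fin m) ℝ) (hJ : ∀ i j, J i j = J j i)
    (σ : Fin m → ℝ) (hσ : ∀ i, σ i * σ i = 1) (hopp : ∀ i k, J i k ≠ 0 → σ i = -σ k)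
    (v : Fin m → ℂ) (h : ∀ i, ∑ k, (J i k : ℂ) * v k = (σ i : ℂ) * v i) : v = 0 := by
  refine eq_zero_of_skew_fixed (fun i k => σ i * J i k) ?_ v ?_
  · intro i k
    show σ i * J i k = -(σ k * J k i)
    rw [hJ k i]
    by_cases hz : J i k = 0
    · simp [hz]
    · rw [hopp i k hz]
      ring
  · intro i
    show ∑ k, ((σ i * J i k : ℝ) : ℂ) * v k = v i
    have e : ∀ k, ((σ i * J i k : ℝ) : ℂ) * v k = (σ i : ℂ) * ((J i k : ℂ) * v k) := by
      intro k
      push_cast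
      ring
    simp_rw [e]
    rw [← Finset.mul_sum, h i, ← mul_assoc, ← Complex.ofReal_mul, hσ i, Complex.ofReal_one, one_mul]

/-- Determinant form of `eq_zero_of_oppositeSign_coupling`: `det(diag σ − J) ≠ 0` over `ℂ`. -/
theorem det_diagonal_sub_ne_zero (J : Matrix (Fin m) (Fin m) ℝ) (hJ : ∀ i j, J i j = J j i)
    (σ : Fin m → ℝ) (hσ : ∀ i, σ i * σ i = 1) (hopp : ∀ i k, J i k ≠ 0 → σ i = -σ k) :
    (Matrix.diagonal (fun i => (σ i : ℂ)) - J.map ((↑) : ℝ → ℂ)).det ≠ 0 := by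
  intro hdet
  obtain ⟨v, hv0, hv⟩ := Matrix.exists_mulVec_eq_zero_iff.2 hdet
  have h : ∀ i, ∑ k, (J i k : ℂ) * v k = (σ i : ℂ) * v i := by
    intro i
    have hi := congrFun hv i
    simp only [Matrix.sub_mulVec, Pi.sub_apply, Matrix.mulVec_diagonal, Pi.zero_apply, sub_eq_zero] at hi
    rw [hi]
    simp [Matrix.mulVec, dotProduct, Matrix.map_apply]
  exact hv0 (eq_zero_of_oppositeSign_coupling J hJ σ hσ hopp v h)

end Summit.ValiantsHypothesis.ValiantsHypothesis.Theorems.KPlusLogSqLaw.StripNoCrossing
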